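import Literature.Analysis.OperatorTheory.PositiveKernelEigenfunction
import Literature.Analysis.OperatorTheory.KernelIterateBridge
import HarnessLib

/-!
# The ground-state-transformed Markov operator of a strictly positive symmetric kernel contracts
# mean-zero functions in `L²(h² dμ)` (Jentzsch gap ⇒ exponential mixing rate) — PROVED

Topic `Literature/Analysis/OperatorTheory`; theorems only (no definitions, no named facts).
Companion of `PositiveKernelTransferOperator.lean` (the transfer operator `A` of a bounded,
symmetric, strictly positive kernel `K` on the real `L²` of a finite measure `μ`),
`PositivityImprovingSpectralGap.lean` (`IsPositivityImproving.exists_spectralGap`,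
`norm_pow_apply_sub_le_of_gap`), `PositiveKernelEigenfunction.lean` (the pointwise, everywhere
positive eigenfunction `h`, `∫ K(x,y) h(y) dμ = λ₀ h(x)`, `∫ h² dμ = 1`) and
`KernelIterateBridge.lean` (`Aⁿ [v] =ᵐ κⁿ v`).

For the stationary Markov chain built from `K` (ground-state / Doob `h`-transform: transition
density `p(x,y) = (λ₀ h(x))⁻¹ K(x,y) h(y)` w.r.t. `μ`, invariant law `h² dμ`) the relevant operator is
the REAL one-step operator `(Pu)(x) = ∫ (λ₀ h(x))⁻¹ K(x,y) h(y) u(y) dμ(y)`, which is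
`h⁻¹ (λ₀⁻¹ A) h`. This file PROVES:

* `toLp_eigenfunction_eq_norm` — the pointwise eigenfunction is a top eigenvector: its
  eigenvalue is `‖A‖` and its class is proportional to the Jentzsch eigenvector (positivity of
  `⟪φ₀, h⟫`), so the gap `‖Aw‖ ≤ θ‖w‖` holds on `h^⊥`;
* `kernelIterate_mul_eigenfunction` — `κⁿ (h u) = λ₀ⁿ h · Pⁿ u` pointwise;
* `exists_groundState_markov_gap` — **main**: `λ₀, h, B, θ` with `0 ≤ θ < λ₀` and, for every
  bounded measurable `u` with `∫ u h² dμ = 0` and every `n`,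
  `∫ (Pⁿu)² h² dμ ≤ (θ/λ₀)^{2n} ∫ u² h² dμ`.

This is the spectral input (`hgap`) of the exponential `ρ`-mixing bound for one-dimensional
Gibbs states / stationary Markov chains of transfer kernels
(`Literature.Probability.LatticeModels.abs_integral_mul_sub_le_of_dependsOn_halfLine`).
[cite: ReedSimonIV1978, Thm XIII.43 and Thm XIII.44]
-/

noncomputable section

open MeasureTheory Set Filter Function
open scoped RealInnerProductSpace ENNReal

namespace Literature.Analysis.OperatorTheory

variable {X : Type*} [MeasurableSpace X] {μ : Measure X} [IsFiniteMeasure μ]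
  {K : X → X → ℝ} {C : ℝ} {A : Lp ℝ 2 μ →L[ℝ] Lp ℝ 2 μ}

/-- **A strictly positive pointwise eigenfunction is a top eigenvector.** If `A` (kernel `K`) is
self-adjoint with Jentzsch data — a unit a.e. strictly positive `φ₀` with `Aφ₀ = ‖A‖φ₀` spanning
the top eigenspace — and `h > 0` is bounded measurable with `∫ K(x,y) h(y) dμ(y) = λ₀ h(x)`
everywhere, then `A[h] = λ₀[h]`, `λ₀ = ‖A‖` and `[h] = ⟪φ₀, [h]⟫ φ₀` with `⟪φ₀, [h]⟫ > 0`.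
[cite: ReedSimonIV1978, Thm XIII.43 and Thm XIII.44] -/
theorem toLp_eigenfunction_eq_norm (hμ : μ ≠ 0)
    (hA : ∀ φ : Lp ℝ 2 μ, (A φ : X → ℝ) =ᵐ[μ] fun x => ∫ y, K x y * φ y ∂μ)
    (hsa : IsSelfAdjoint A) {φ₀ : Lp ℝ 2 μ} (hφ₀pos : IsStrictlyPositiveFun φ₀)
    (hAφ₀ : A φ₀ = ‖A‖ • φ₀) (hsimple : ∀ η : Lp ℝ 2 μ, A η = ‖A‖ • η → η = ⟪φ₀, η⟫ • φ₀)
    {lam : ℝ} {h : X → ℝ} (hhm : Measurable h) (hhpos : ∀ x, 0 < h x) {B : ℝ}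
    (hhb : ∀ x, ‖h x‖ ≤ B) (heig : ∀ x, ∫ y, K x y * h y ∂μ = lam * h x) :
    A ((memLp_two_of_bound (μ := μ) hhm hhb).toLp h) =
        lam • (memLp_two_of_bound (μ := μ) hhm hhb).toLp h ∧ lam = ‖A‖ ∧
      0 < ⟪φ₀, (memLp_two_of_bound (μ := μ) hhm hhb).toLp h⟫ ∧
      (memLp_two_of_bound (μ := μ) hhm hhb).toLp h =
        ⟪φ₀, (memLp_two_of_bound (μ := μ) hhm hhb).toLp h⟫ • φ₀ := by
  set hL : Lp ℝ 2 μ := (memLp_two_of_bound (μ := μ) hhm hhb).toLp h with hhL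
  have hcoe : (hL : X → ℝ) =ᵐ[μ] h := MemLp.coeFn_toLp _
  have hAh : A hL = lam • hL := by
    refine Lp.ext ?_
    filter_upwards [hA hL, Lp.coeFn_smul lam hL, hcoe] with x hx hs hc
    rw [hx, hs, Pi.smul_apply, smul_eq_mul, hc, ← heig x]
    exact integral_congr_ae (by filter_upwards [hcoe] with y hy; rw [hy])
  have hLpos : IsStrictlyPositiveFun hL := by
    unfold IsStrictlyPositiveFun
    filter_upwards [hcoe] with x hx
    rw [hx]; exact hhpos x
  have hip : 0 < ⟪φ₀, hL⟫ := inner_pos (hφ₀pos.isPositiveFun hμ) hLpos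
  have hlamA : lam = ‖A‖ := by
    have e1 : ⟪A φ₀, hL⟫ = ‖A‖ * ⟪φ₀, hL⟫ := by rw [hAφ₀, real_inner_smul_left]
    have e2 : ⟪A φ₀, hL⟫ = lam * ⟪φ₀, hL⟫ := by
      rw [hsa.isSymmetric.apply_clm, hAh, real_inner_smul_right]
    exact (mul_right_cancel₀ hip.ne' (e1.symm.trans e2)).symm
  exact ⟨hAh, hlamA, hip, hsimple hL (by rw [hAh, hlamA])⟩

omit [IsFiniteMeasure μ] in
/-- **`κⁿ (h u) = λ₀ⁿ h · Pⁿ u`**: the iterates of the pointwise kernel operator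
`(κ f)(x) = ∫ K(x,y) f(y) dμ` on `h u` are the iterates of the ground-state-transformed operator
`(Pv)(x) = ∫ (λ₀ h(x))⁻¹ K(x,y) h(y) v(y) dμ` on `u`, times `λ₀ⁿ h`. [folklore] -/
theorem kernelIterate_mul_eigenfunction {lam : ℝ} (hlam : 0 < lam) {h : X → ℝ}
    (hhpos : ∀ x, 0 < h x) (u : X → ℝ) (n : ℕ) :
    (fun f : X → ℝ => fun x => ∫ y, K x y * f y ∂μ)^[n] (fun x => h x * u x) =
      fun x => lam ^ n * (h x *
        ((fun (v : X → ℝ) (x : X) => ∫ y, (lam * h x)⁻¹ * K x y * h y * v y ∂μ)^[n] u) x) := by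
  induction n with
  | zero => funext x; simp
  | succ n ih =>
    rw [Function.iterate_succ_apply', ih, Function.iterate_succ_apply']
    funext x
    have hx := (hhpos x).ne'
    have hl := hlam.ne'
    rw [← integral_const_mul, ← integral_const_mul]
    refine integral_congr_ae (ae_of_all _ fun y => ?_)
    dsimp only
    field_simp
    ring

/-- **The ground-state-transformed Markov operator of a strictly positive symmetric bounded kernel
contracts mean-zero functions in `L²(h² dμ)`.** For `K` jointly measurable, `‖K‖ ≤ C`, symmetric,
strictly positive on a nonzero finite measure space: there are `λ₀ > 0`, a measurable `h` with
`0 < h ≤ B`, `∫ K(x,y) h(y) dμ(y) = λ₀ h(x)` for all `x`, `∫ h² dμ = 1`, and `0 ≤ θ < λ₀` such that for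
every bounded measurable `u` with `∫ u h² dμ = 0` and every `n`,
`∫ (Pⁿu)² h² dμ ≤ (θ/λ₀)^{2n} ∫ u² h² dμ`, `(Pv)(x) = ∫ (λ₀ h(x))⁻¹ K(x,y) h(y) v(y) dμ(y)`
(Jentzsch's gap for `A` transported by the unitary `u ↦ h u : L²(h²dμ) → L²(dμ)`, under which
`P = h⁻¹ (λ₀⁻¹ A) h`). [cite: ReedSimonIV1978, Thm XIII.43 and Thm XIII.44] -/
theorem exists_groundState_markov_gap (hK : StronglyMeasurable (uncurry K))
    (hC : ∀ x y, ‖K x y‖ ≤ C) (hsymm : ∀ x y, K x y = K y x) (hpos : ∀ x y, 0 < K x y)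
    (hμ : μ ≠ 0) :
    ∃ (lam : ℝ) (h : X → ℝ) (B θ : ℝ), 0 < lam ∧ Measurable h ∧ (∀ x, 0 < h x) ∧ (∀ x, h x ≤ B) ∧
      (∀ x, ∫ y, K x y * h y ∂μ = lam * h x) ∧ ∫ x, h x ^ 2 ∂μ = 1 ∧ 0 ≤ θ ∧ θ < lam ∧
      ∀ u : X → ℝ, Measurable u → (∃ M : ℝ, ∀ x, |u x| ≤ M) → ∫ x, u x * h x ^ 2 ∂μ = 0 →
        ∀ n : ℕ, ∫ x, ((fun (v : X → ℝ) (x : X) => ∫ y, (lam * h x)⁻¹ * K x y * h y * v y ∂μ)^[n] u) x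
          ^ 2 * h x ^ 2 ∂μ ≤ (θ / lam) ^ (2 * n) * ∫ x, u x ^ 2 * h x ^ 2 ∂μ := by
  obtain ⟨A, hA, hsa, hcpt, himp, hA0⟩ := exists_transferOperator (μ := μ) hK hC hsymm hpos hμ
  obtain ⟨φ₀, -, hφ₀pos, hAφ₀, hsimple, θ, hθ0, hθlt, hgapA⟩ := himp.exists_spectralGap hsa hcpt hA0
  obtain ⟨lam, h, B, hlam, hhm, hhpos, hhle, -, heig, -, hnorm⟩ :=
    exists_pointwise_eigenfunction (μ := μ) hK hC hsymm hpos hμ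
  have hhb : ∀ x, ‖h x‖ ≤ B := fun x => by
    rw [Real.norm_eq_abs, abs_of_pos (hhpos x)]; exact hhle x
  obtain ⟨hAh, hlamA, hip, hprop⟩ :=
    toLp_eigenfunction_eq_norm hμ hA hsa hφ₀pos hAφ₀ hsimple hhm hhpos hhb heig
  set hL : Lp ℝ 2 μ := (memLp_two_of_bound (μ := μ) hhm hhb).toLp h with hhL
  have hcoe : (hL : X → ℝ) =ᵐ[μ] h := MemLp.coeFn_toLp _
  have hgap_h : ∀ w : Lp ℝ 2 μ, ⟪hL, w⟫ = 0 → ‖A w‖ ≤ θ * ‖w‖ := fun w hw => hgapA w (by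
    rw [hprop, real_inner_smul_left] at hw
    exact (mul_eq_zero.1 hw).resolve_left hip.ne')
  have hnormh : ‖hL‖ = 1 := by
    have h1 : ‖hL‖ ^ 2 = 1 := by
      rw [← real_inner_self_eq_norm_sq, inner_eq_integral, ← hnorm]
      refine integral_congr_ae ?_
      filter_upwards [hcoe] with x hx
      rw [hx, sq]
    have h2 := norm_nonneg hL
    nlinarith
  refine ⟨lam, h, B, θ, hlam, hhm, hhpos, hhle, heig, hnorm, hθ0, by rwa [hlamA], ?_⟩
  intro u hum hub hmean n
  obtain ⟨M, huM⟩ := hub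
  have hvm : Measurable fun x => h x * u x := hhm.mul hum
  have hM : 0 ≤ M := (abs_nonneg _).trans (huM (nonempty_of_measure_ne_zero
    (fun h0 => hμ (Measure.measure_univ_eq_zero.1 h0))).some)
  have hvb : ∀ x, ‖h x * u x‖ ≤ B * M := fun x => by
    rw [norm_mul, Real.norm_eq_abs (u x)]
    exact mul_le_mul (hhb x) (huM x) (abs_nonneg _) ((norm_nonneg _).trans (hhb x))
  set vL : Lp ℝ 2 μ := (memLp_two_of_bound (μ := μ) hvm hvb).toLp (fun x => h x * u x) with hvL
  have hvcoe : (vL : X → ℝ) =ᵐ[μ] fun x => h x * u x := MemLp.coeFn_toLp _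
  set W : X → ℝ := (fun (v : X → ℝ) (x : X) => ∫ y, (lam * h x)⁻¹ * K x y * h y * v y ∂μ)^[n] u
    with hW
  -- `Aⁿ [h u] = λ₀ⁿ h Pⁿu` a.e.
  have hAe : ((A ^ n) vL : X → ℝ) =ᵐ[μ] fun x => lam ^ n * (h x * W x) := by
    have h1 := pow_kernelOp_toLp_ae_eq_iterate hA hvm hvb n
    rw [kernelIterate_mul_eigenfunction (K := K) (μ := μ) hlam hhpos u n] at h1
    exact h1
  -- `[h] ⊥ [h u]`
  have hin : ⟪hL, vL⟫ = 0 := by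
    rw [inner_eq_integral, ← hmean]
    refine integral_congr_ae ?_
    filter_upwards [hcoe, hvcoe] with x hx hv
    rw [hx, hv]
    ring
  have hN1 : ‖(A ^ n) vL‖ ^ 2 = lam ^ (2 * n) * ∫ x, W x ^ 2 * h x ^ 2 ∂μ := by
    rw [← real_inner_self_eq_norm_sq, inner_eq_integral, ← integral_const_mul]
    refine integral_congr_ae ?_
    filter_upwards [hAe] with x hx
    rw [hx]
    ring
  have hN2 : ‖vL‖ ^ 2 = ∫ x, u x ^ 2 * h x ^ 2 ∂μ := by
    rw [← real_inner_self_eq_norm_sq, inner_eq_integral]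
    refine integral_congr_ae ?_
    filter_upwards [hvcoe] with x hv
    rw [hv]
    ring
  have hb := norm_pow_apply_sub_le_of_gap hsa hnormh hAh hθ0 hgap_h n vL
  rw [hin, mul_zero, zero_smul, sub_zero] at hb
  have hsq : ‖(A ^ n) vL‖ ^ 2 ≤ (θ ^ n * ‖vL‖) ^ 2 := pow_le_pow_left₀ (norm_nonneg _) hb 2
  rw [hN1, mul_pow, ← pow_mul, hN2, mul_comm n 2] at hsq
  rw [div_pow, div_mul_eq_mul_div, le_div_iff₀ (pow_pos hlam _), mul_comm]
  exact hsq

end Literature.Analysis.OperatorTheory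

end
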